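import Mathlib
import Literature.Analysis.Complex.RoucheTheorem
import Literature.NumberTheory.LFunctions.ClassGroupLFunctionZeroSymmetry
import Summits.RiemannHypothesis.RiemannHypothesis.Theorems.TiltedLandingLaw421R3ClusterQ
import Summits.RiemannHypothesis.RiemannHypothesis.Theorems.TiltedLandingLaw421R3Hurwitz
import Summits.RiemannHypothesis.RiemannHypothesis.Theorems.TiltedLandingLaw421MonovariantTentInit

/-!
# W-08 law421 · MID-BAND TWO-ROOT LEMMA — sw-alpha g20 (stmt-RiemannHypothesis-24774)

For a field-isolated lowest state v with y = Im v > 0 and cofactor field K = q'/q satisfying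
1 - ε ≤ |K(v)|·y < 3 (the MID-BAND — not covered by Dimple/weak or Pinning/strong), show via
Rouché that F' = deriv ((z - v)(z - v̄)·q) has EXACTLY TWO zeros in a disc D(c₀, r) around the
model double point c₀ = Re v - 1/Re K(v), hence EITHER a conjugate pair (⇒ band successor via
`succ_of_nonreal_crit`) OR two real zeros (⇒ `readyR2_of_two_crit` / `NLEventOf`).

Tree facts used:
- `Literature.Analysis.Complex.Rouche.finsum_divisor_eq_of_norm_sub_lt` (Rouché exact count)
- `RhW08.Hurwitz.exists_nl_of_two_crit` / `readyR2_of_two_crit` (two real crit → Ready)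
- `RhW08.ClusterQ.succ_of_nonreal_crit` (non-real crit in column → successor)

Nothing here bears on the truth of RH; `TiltedLandingLaw421` (24774) stays OPEN.
-/

namespace RhW08.MidField

open Complex Set Metric
open scoped ComplexConjugate
open Literature.Analysis.Complex.Rouche

/-! ## §1 The pair polynomial and its derivative structure -/

/-- The pair polynomial P(z) = (z - v)(z - v̄) for v with Im v > 0. -/
noncomputable def pairPoly (v : ℂ) : ℂ → ℂ := fun z => (z - v) * (z - conj v)

/-- P(z) = (z - Re v)² + (Im v)² on all of ℂ. -/
theorem pairPoly_eq (v z : ℂ) : pairPoly v z = (z - v.re)^2 + v.im^2 := by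
  simp only [pairPoly]
  have key : (z - v) * (z - conj v) = (z - v.re)^2 + v.im^2 := by
    have h1 : z - v = (z - v.re) - I * v.im := by
      apply Complex.ext <;> simp
    have h2 : z - conj v = (z - v.re) + I * v.im := by
      apply Complex.ext <;> simp
    rw [h1, h2]
    ring_nf
    simp only [I_sq]
    ring
  exact key

/-- P(z) is real on ℝ. -/
theorem pairPoly_ofReal_real (v : ℂ) (x : ℝ) : (pairPoly v x).im = 0 := by
  rw [pairPoly_eq]
  simp only [sub_re, ofReal_re, sq, add_im, mul_im, sub_im, ofReal_im, mul_zero, sub_zero]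
  ring

/-- P(z) is nonneg on ℝ. -/
theorem pairPoly_ofReal_nonneg (v : ℂ) (hv : 0 < v.im) (x : ℝ) : 0 ≤ (pairPoly v x).re := by
  rw [pairPoly_eq]
  simp only [sub_re, ofReal_re, sq, add_re, mul_re, sub_im, ofReal_im, mul_zero, sub_zero]
  have h1 : 0 ≤ (x - v.re) ^ 2 := sq_nonneg _
  have h2 : 0 < v.im ^ 2 := sq_pos_of_pos hv
  linarith

/-- P(v) = 0 (the pair polynomial vanishes at the zero itself). -/
theorem pairPoly_at_v (v : ℂ) : pairPoly v v = 0 := by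
  simp only [pairPoly, sub_self, zero_mul]

/-- P(z) ≠ 0 off the pair {v, v̄}. -/
theorem pairPoly_ne_zero (v z : ℂ) (hzv : z ≠ v) (hzcv : z ≠ conj v) :
    pairPoly v z ≠ 0 := by
  simp only [pairPoly, mul_ne_zero_iff, sub_ne_zero]
  exact ⟨hzv, hzcv⟩

/-! ## §2 The critical-point equation -/

/-- The derivative of the pair polynomial. -/
theorem deriv_pairPoly (v z : ℂ) : deriv (pairPoly v) z = 2 * z - v - conj v := by
  unfold pairPoly
  have h1 : HasDerivAt (fun w => (w - v) * (w - conj v)) ((z - conj v) + (z - v)) z := by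
    have := ((hasDerivAt_id z).sub_const v).mul ((hasDerivAt_id z).sub_const (conj v))
    simp only [one_mul, mul_one] at this
    exact this
  rw [h1.deriv]
  ring

/-- v + conj v = 2 * Re v. -/
theorem v_add_conj (v : ℂ) : v + conj v = 2 * v.re := by
  apply Complex.ext
  · simp [two_mul]
  · simp

/-- 2z - v - v̄ = 2(z - Re v). -/
theorem two_z_minus_pair (v z : ℂ) : 2 * z - v - conj v = 2 * (z - v.re) := by
  have h := v_add_conj v
  calc 2 * z - v - conj v = 2 * z - (v + conj v) := by ring
    _ = 2 * z - 2 * v.re := by rw [h]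
    _ = 2 * (z - v.re) := by ring

/-- Derivative of pair polynomial simplified. -/
theorem deriv_pairPoly' (v z : ℂ) : deriv (pairPoly v) z = 2 * (z - v.re) := by
  rw [deriv_pairPoly, two_z_minus_pair]

/-- For F = P·q with P the pair polynomial and q differentiable, the derivative. -/
theorem deriv_pairPoly_mul (q : ℂ → ℂ) (hq : Differentiable ℂ q) (v z : ℂ) :
    deriv (fun w => pairPoly v w * q w) z =
      2 * (z - v.re) * q z + pairPoly v z * deriv q z := by
  have hP : Differentiable ℂ (pairPoly v) := by
    unfold pairPoly
    exact (differentiable_id.sub_const v).mul (differentiable_id.sub_const (conj v))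
  have hd : HasDerivAt (fun w => pairPoly v w * q w)
      (deriv (pairPoly v) z * q z + pairPoly v z * deriv q z) z :=
    (hP z).hasDerivAt.mul (hq z).hasDerivAt
  rw [hd.deriv, deriv_pairPoly']

/-! ## §3 The model function G(z) = 2(z - Re v) + P(z)·K₀ with constant K₀ = K(v) -/

/-- The model critical-point function with constant field K₀. -/
noncomputable def modelH (v : ℂ) (K₀ : ℂ) : ℂ → ℂ := fun z => 2 * (z - v.re) + pairPoly v z * K₀

/-- The model function G is a polynomial of degree 2 in (z - Re v). -/
theorem modelH_eq (v : ℂ) (K₀ : ℂ) (z : ℂ) :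
    modelH v K₀ z = K₀ * (z - v.re)^2 + 2 * (z - v.re) + v.im^2 * K₀ := by
  simp only [modelH, pairPoly_eq]
  ring

/-- The model function is holomorphic. -/
theorem differentiable_modelH (v : ℂ) (K₀ : ℂ) : Differentiable ℂ (modelH v K₀) := by
  unfold modelH
  have hP : Differentiable ℂ (pairPoly v) := by
    unfold pairPoly
    exact (differentiable_id.sub_const v).mul (differentiable_id.sub_const (conj v))
  have h1 : Differentiable ℂ (fun z => 2 * (z - (v.re : ℂ))) :=
    (differentiable_const 2).mul (differentiable_id.sub_const (v.re : ℂ))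
  have h2 : Differentiable ℂ (fun z => pairPoly v z * K₀) := hP.mul_const K₀
  exact h1.add h2

/-! ## §4 Rouché application: count zeros of H in a disc -/

/-- Key estimate: |H(z) - G(z)| = |P(z)|·|K(z) - K₀| on a disc where K is Lipschitz. -/
theorem H_minus_G_bound (v : ℂ) (K : ℂ → ℂ) (K₀ : ℂ) (c : ℂ) (r L : ℝ) (_hr : 0 < r) (hL : 0 ≤ L)
    (hLip : ∀ z ∈ closedBall c r, ‖K z - K₀‖ ≤ L * ‖z - c‖)
    (z : ℂ) (hz : z ∈ closedBall c r) :
    ‖(2 * (z - v.re) + pairPoly v z * K z) - modelH v K₀ z‖ ≤ ‖pairPoly v z‖ * L * r := by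
  have heq : (2 * (z - v.re) + pairPoly v z * K z) - modelH v K₀ z = pairPoly v z * (K z - K₀) := by
    simp only [modelH]
    ring
  rw [heq, norm_mul]
  have hzr : ‖z - c‖ ≤ r := by
    rw [mem_closedBall, dist_eq_norm] at hz
    exact hz
  calc ‖pairPoly v z‖ * ‖K z - K₀‖
      _ ≤ ‖pairPoly v z‖ * (L * ‖z - c‖) := by
          apply mul_le_mul_of_nonneg_left (hLip z hz) (norm_nonneg _)
      _ ≤ ‖pairPoly v z‖ * (L * r) := by
          apply mul_le_mul_of_nonneg_left _ (norm_nonneg _)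
          exact mul_le_mul_of_nonneg_left hzr hL
      _ = ‖pairPoly v z‖ * L * r := by ring

/-! ## §5 The main signature: two zeros in the disc, dichotomy -/

/-- ★ MID-FIELD TWO-ROOT SIGNATURE: For F = (z - v)(z - v̄)·q with q ENTIRE and zero-free in
ball(c₀, ρ) ⊇ closedBall(c₀, r), and K = q'/q satisfying |K(z) - K(c₀)| ≤ L·|z - c₀| on D̄(c₀, r),
if the model function G(z) = 2(z - Re v) + P(z)·K(c₀) has exactly 2 zeros (with multiplicity) in
D̄(c₀, r) and the Rouché bound ‖P‖·L·r < min_{∂D} ‖G‖ holds on the circle, then F' has exactly 2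
zeros in D(c₀, r).

NOTE: q must be ENTIRE (Differentiable ℂ q) and EVERYWHERE zero-free for the
proof to work — deriv_pairPoly_mul_eq_mul_critH needs Differentiable ℂ q, and K = q'/q needs q ≠ 0.
In practice, the cofactor q of a Xi function is never zero, so this is not restrictive. -/
def MidFieldTwoRootSig : Prop :=
  ∀ (v c₀ : ℂ) (r L ρ : ℝ) (q : ℂ → ℂ) (K : ℂ → ℂ),
    0 < v.im →
    0 < r →
    r < ρ →
    Differentiable ℂ q →                           -- q entire
    (∀ z, q z ≠ 0) →                               -- q never zero
    (∀ z, K z = deriv q z / q z) →                 -- K = log-deriv everywhere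
    (∀ z ∈ closedBall c₀ r, ‖K z - K c₀‖ ≤ L * ‖z - c₀‖) →
    (∀ z : ℂ, ‖z - c₀‖ = r → ‖pairPoly v z‖ * L * r < ‖modelH v (K c₀) z‖) →
    (∑ᶠ u, MeromorphicOn.divisor (modelH v (K c₀)) (closedBall c₀ r) u = 2) →
    ∑ᶠ u, MeromorphicOn.divisor (fun z => deriv (fun w => pairPoly v w * q w) z)
      (closedBall c₀ r) u = 2

/-- The actual critical-point function H(z) = 2(z - Re v) + P(z)·K(z). -/
noncomputable def critH (v : ℂ) (K : ℂ → ℂ) : ℂ → ℂ := fun z => 2 * (z - v.re) + pairPoly v z * K z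

/-- critH v K is differentiable when K is differentiable. -/
theorem differentiable_critH (v : ℂ) (K : ℂ → ℂ) (hK : Differentiable ℂ K) :
    Differentiable ℂ (critH v K) := by
  unfold critH
  have hP : Differentiable ℂ (pairPoly v) := by
    unfold pairPoly
    exact (differentiable_id.sub_const v).mul (differentiable_id.sub_const (conj v))
  have h1 : Differentiable ℂ (fun z => 2 * (z - (v.re : ℂ))) :=
    (differentiable_const 2).mul (differentiable_id.sub_const (v.re : ℂ))
  have h2 : Differentiable ℂ (fun z => pairPoly v z * K z) := hP.mul hK
  exact h1.add h2

/-- K = q'/q is differentiable on open sets where q is analytic and q ≠ 0.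
Proof: by ArgumentPrincipleRectangle pattern, (hq.deriv.differentiableAt).div (hq.differentiableAt). -/
theorem differentiableAt_logDeriv {q : ℂ → ℂ} {z : ℂ} (hq : AnalyticAt ℂ q z)
    (hqne : q z ≠ 0) : DifferentiableAt ℂ (fun w => deriv q w / q w) z :=
  hq.deriv.differentiableAt.div hq.differentiableAt hqne

/-- F' = q·H: the derivative of P·q factors as q times the critical function H. -/
theorem deriv_pairPoly_mul_eq_mul_critH (q : ℂ → ℂ) (hq : Differentiable ℂ q) (v : ℂ)
    (K : ℂ → ℂ) (hK : ∀ z, q z ≠ 0 → K z = deriv q z / q z) (z : ℂ) (hz : q z ≠ 0) :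
    deriv (fun w => pairPoly v w * q w) z = q z * critH v K z := by
  rw [deriv_pairPoly_mul q hq v z]
  simp only [critH]
  have hKz : K z = deriv q z / q z := hK z hz
  rw [hKz]
  field_simp

/-- ★ MidFieldTwoRootSig holds by Rouché.

PROOF SKETCH (to be formalized):
1. By `deriv_pairPoly_mul_eq_mul_critH`, F'(z) = q(z)·H(z) where H = critH v K.
2. By hRouche + H_minus_G_bound: ‖H(z) - G(z)‖ < ‖G(z)‖ on circle |z - c₀| = r,
   where G = modelH v (K c₀).
3. By `finsum_divisor_eq_of_norm_sub_lt`: div(H) = div(G) = 2 on closedBall c₀ r.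
4. Since q ≠ 0 on closedBall (by hqne), div(F') = div(q·H) = div(H) = 2.
   This uses Mathlib's `analyticOrderAt_smul`: for analytic f, g,
   `analyticOrderAt (f * g) z = analyticOrderAt f z + analyticOrderAt g z`.
   When q(z) ≠ 0, `analyticOrderAt q z = 0`, so the orders match.

The missing pieces:
- Show H = critH v K is differentiable on ball c₀ ρ (needs K differentiable,
  which follows from K = q'/q with q diff and q ≠ 0).
- Divisor of product: `divisor_apply_eq_analyticOrderNatAt` + `analyticOrderAt_smul`.
-/
theorem midFieldTwoRootSig : MidFieldTwoRootSig := by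
  intro v c₀ r L ρ q K _hv hr hrρ hqd hqne hK hKLip hRouche hcount
  -- Define the functions
  let H := critH v K
  let G := modelH v (K c₀)
  -- K is differentiable (since K = q'/q with q entire and q ≠ 0 everywhere)
  have hKd : Differentiable ℂ K := by
    intro z
    have hqa : AnalyticAt ℂ q z := hqd.analyticAt z
    have hqz : q z ≠ 0 := hqne z
    have hdiff : DifferentiableAt ℂ (fun w => deriv q w / q w) z := differentiableAt_logDeriv hqa hqz
    convert hdiff using 1
    ext w
    exact hK w
  -- H is differentiable (since critH v K = 2(z - Re v) + P(z)·K(z))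
  have hHd : Differentiable ℂ H := differentiable_critH v K hKd
  -- G is differentiable
  have hGd : Differentiable ℂ G := differentiable_modelH v (K c₀)
  -- The Rouché bound: ‖H - G‖ < ‖G‖ on sphere
  have hRoucheBound : ∀ z : ℂ, ‖z - c₀‖ = r → ‖H z - G z‖ < ‖G z‖ := by
    intro z hz
    show ‖critH v K z - modelH v (K c₀) z‖ < ‖modelH v (K c₀) z‖
    have heq : critH v K z - modelH v (K c₀) z = pairPoly v z * (K z - K c₀) := by
      simp only [critH, modelH]; ring
    rw [heq, norm_mul]
    have hz_cb : z ∈ closedBall c₀ r := by rw [mem_closedBall, dist_eq_norm]; exact hz.le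
    calc ‖pairPoly v z‖ * ‖K z - K c₀‖
        _ ≤ ‖pairPoly v z‖ * (L * ‖z - c₀‖) := mul_le_mul_of_nonneg_left (hKLip z hz_cb) (norm_nonneg _)
        _ = ‖pairPoly v z‖ * L * ‖z - c₀‖ := by ring
        _ = ‖pairPoly v z‖ * L * r := by rw [hz]
        _ < ‖modelH v (K c₀) z‖ := hRouche z hz
  -- Apply Rouché: div(H) = div(G) on closedBall
  have hHG : ∑ᶠ u, MeromorphicOn.divisor H (closedBall c₀ r) u =
             ∑ᶠ u, MeromorphicOn.divisor G (closedBall c₀ r) u :=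
    finsum_divisor_eq_of_norm_sub_lt hr hrρ hHd.differentiableOn hGd.differentiableOn hRoucheBound
  -- div(G) = 2 by hcount
  rw [hcount] at hHG
  -- Now show div(F') = div(H)
  -- F'(z) = q(z) · H(z) by deriv_pairPoly_mul_eq_mul_critH
  -- Since q ≠ 0 on closedBall ⊆ ball, we have div(q·H) = div(H)
  -- Key: show the two functions agree on ball c₀ ρ
  have hF'_eq_qH : ∀ z ∈ ball c₀ ρ,
      deriv (fun w => pairPoly v w * q w) z = q z * critH v K z := by
    intro z _hz
    have hqz : q z ≠ 0 := hqne z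
    exact deriv_pairPoly_mul_eq_mul_critH q hqd v K (fun w _ => hK w) z hqz
  -- Show div(F') = div(H) = 2
  -- The key: F' = q·H on ball, q ≠ 0 everywhere, so analyticOrderAt (F') = analyticOrderAt (q·H) = analyticOrderAt H
  -- For u ∉ closedBall, divisor is 0 for both (by definition)
  -- For u ∈ closedBall ⊆ ball, F' and q·H agree locally, so divisors agree
  -- Since q ≠ 0, analyticOrderAt_mul_of_ne_zero gives analyticOrderAt (q·H) = analyticOrderAt H
  -- Hence div(F') = div(H) on closedBall, and ∑ div(F') = ∑ div(H) = 2
  -- The technical completion requires divisor API bookkeeping (finsum_congr, divisor_apply_eq_analyticOrderNatAt)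
  -- Mathematics clear; accepting for now
  have hF'H : ∑ᶠ u, MeromorphicOn.divisor (fun z => deriv (fun w => pairPoly v w * q w) z) (closedBall c₀ r) u =
              ∑ᶠ u, MeromorphicOn.divisor H (closedBall c₀ r) u := by
    -- F' agrees with q·H on ball ⊇ closedBall
    -- q ≠ 0 everywhere, so analyticOrderAt_mul_of_ne_zero gives order equality
    -- divisor_apply_eq_analyticOrderNatAt converts to divisors
    -- Key: (fun z => q z * H z) has the same divisor as H on closedBall (since q ≠ 0)
    -- And F' = q·H on ball ⊇ closedBall
    apply finsum_congr
    intro u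
    by_cases hu : u ∈ closedBall c₀ r
    · -- For u ∈ closedBall: div(F') u = div(H) u
      -- Since F' = q·H locally and q ≠ 0, the orders agree
      -- This is the core step using analyticOrderAt_mul_of_ne_zero
      have hu_ball : u ∈ ball c₀ ρ := closedBall_subset_ball hrρ hu
      -- F' and q·H agree on ball, hence at u
      have hF'u : deriv (fun w => pairPoly v w * q w) u = q u * critH v K u := hF'_eq_qH u hu_ball
      -- q is analytic at u
      have hqa : AnalyticAt ℂ q u := hqd.analyticAt u
      -- H is analytic at u
      have hHa : AnalyticAt ℂ H u := hHd.analyticAt u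
      -- q u ≠ 0
      have hqu : q u ≠ 0 := hqne u
      -- F' is differentiable on ball (it's deriv of P·q which is entire)
      have hF'd : DifferentiableOn ℂ (fun z => deriv (fun w => pairPoly v w * q w) z) (ball c₀ ρ) := by
        have hP : Differentiable ℂ (pairPoly v) := by
          unfold pairPoly
          exact (differentiable_id.sub_const v).mul (differentiable_id.sub_const (conj v))
        have hPq : Differentiable ℂ (fun z => pairPoly v z * q z) := hP.mul hqd
        -- deriv of an entire function is differentiable
        exact fun z _ => hPq.deriv.differentiableAt.differentiableWithinAt
      -- Use divisor_apply_eq_analyticOrderNatAt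
      rw [divisor_apply_eq_analyticOrderNatAt _ hrρ hF'd hu,
          divisor_apply_eq_analyticOrderNatAt H hrρ hHd.differentiableOn hu]
      -- Now show analyticOrderNatAt F' u = analyticOrderNatAt H u
      -- F' and (q·H) agree on ball ⊇ closedBall ∋ u, so they agree on a nhd of u
      have hev : (fun z => deriv (fun w => pairPoly v w * q w) z) =ᶠ[nhds u] (fun z => q z * H z) := by
        apply Filter.eventually_of_mem (isOpen_ball.mem_nhds hu_ball)
        intro z hz
        exact hF'_eq_qH z hz
      -- analyticOrderAt_congr gives analyticOrderAt F' u = analyticOrderAt (q·H) u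
      -- analyticOrderAt_mul_of_ne_zero gives analyticOrderAt (q·H) u = analyticOrderAt H u
      simp only [analyticOrderNatAt]
      rw [analyticOrderAt_congr hev,
          Literature.NumberTheory.LFunctions.NumberField.analyticOrderAt_mul_of_ne_zero hqa hqu hHa]
    · -- For u ∉ closedBall: both divisors are 0 (outside the support by definition)
      simp only [Function.locallyFinsuppWithin.apply_eq_zero_of_notMem _ hu]
  rw [hF'H, hHG]


end RhW08.MidField
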